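import Summits.Schanuel.Schanuel.Theorems.ZilberEacCancellingFibreExistence
import Summits.Schanuel.Schanuel.Theorems.ZilberEacPowerGrowthElimination
import Summits.Schanuel.Schanuel.Theorems.ZilberEacRealHyperplaneDensity
import HarnessLib

/-!
# The cancelling-fibre regime: Zariski density of
# `{x₂ = r₀x₀ + r₁x₁ + c, y₀ = x₀ + y₂F₀(y₂), y₁ = x₁ + y₂F₁(y₂)}` — in particular for ALL `r₀, r₁ > 0`

Zilber's Exponential-Algebraic Closedness, case ladder (host summit Schanuel, cell `pub-schanuel`,
seat 2, gen 15).  THE FAMILY (`F₀, F₁ ∈ ℂ[u]`, `F₀ ≠ 0`, `r₀, r₁ ∈ ℝ`, `c ∈ ℂ`):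

  `W = {x₂ = r₀x₀ + r₁x₁ + c,  y₀ = x₀ + y₂F₀(y₂),  y₁ = x₁ + y₂F₁(y₂)} ⊆ ℂ³ × ℂ³`.

After gen 8–14 the slow (THEOREM R⁺), mixed (R⁺⁺) and critical (IFT at the coupled limit system)
sizes were decided and the SUPER-CRITICAL sizes were the open clause O57/O58 (a) ("no relatively
small perturbation of lattice centres exists").  THE CANCELLING-FIBRE REGIME
(`ZilberEacCancellingFibreExistence`) needs no smallness of `y₂F₀(y₂)` at all: the fibre `j = 0`
is solved by `x₀ ≈ -y₂F₀(y₂)` with `e^{x₀}` negligible, the fibre `j = 1` is slow, and the base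
value `x₂` carries a second free label.  In the coordinates `(y₀, x₁, y₂)` of `W` the solutions have
THREE INDEPENDENT POWER GROWTH RATES `|y₀| ≍ m^{(β/e₀ - r₁)/r₀}`, `|x₁| ≍ m`, `|y₂| ≍ m^{β/e₀}`
with a free real parameter `β` (`e₀ = deg F₀ + 1`, `e₁ = deg F₁ + 1`; conditions `β > 0`,
`βe₁ < e₀`, `(β/e₀ - r₁)/r₀ < β`), so THEOREM I⁽ᵏ⁾ (`unprojectedDense_of_powerGrowth_family`: for
each test polynomial `H` a `β` making the monomial weights injective on the support of `H`,
`exists_mem_injOn_affine` + `cancellingWeights_injective`) gives: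

* **`unprojectedDense_polyFibredGraph_cancelling`** — `r₀ ≠ 0`, `r₀ ∉ ℚ ∨ r₁ ∉ ℚ`, `F₀ ≠ 0`, and
  ONE admissible `β` ⟹ `I(W ∩ Γ_exp) = I(W)`;
* (`ZilberEacCancellingFibrePositive`) **`unprojectedDense_polyFibredGraph_hyperplane_pos`** —
  `r₀ > 0`, `r₁ > 0`, `r₀ ∉ ℚ ∨ r₁ ∉ ℚ`, `F₀ ≠ 0`, ANY `F₁`, ANY `c` ⟹ `I(W ∩ Γ_exp) = I(W)`: EVERY
  size — slow, mixed, critical, super-critical — over a real plane with positive coefficients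
  (small `β` is admissible), with certified membership in `EC(3,2)` and examples.

HONEST FRAMING: explicit families inside an OPEN cell (negative or vanishing coefficients are only
partly covered — by the admissible-`β` form and by the slow regime; the resonant line
`e₀r₀ + e₁r₁ = 1` with `r₀r₁ < 0` and targets of higher degree stay as before); `EC(3,2)` OPEN;
NOT Schanuel's conjecture; EAC ⇏ SC.
-/

noncomputable section

open Complex MvPolynomial Filter Topology
open Literature.NumberTheory.Transcendental Literature.ModelTheory.Zilber
  Literature.ModelTheory.ExponentialFields

set_option linter.dupNamespace false

namespace Summit.Schanuel.Schanuel.Theorems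

section Weights

/-- **The monomial weights of the cancelling regime are jointly injective.**  With
`L₁(d) = d₁ - d₀r₁/r₀` and `L₂(d) = d₀/(e₀r₀) + d₂/e₀` (so that the weight of `y₀^{d₀}x₁^{d₁}y₂^{d₂}`
is `L₁ + βL₂`): `L₁(d) = L₁(d')`, `L₂(d) = L₂(d')` force `d = d'` as soon as `r₀ ≠ 0` and one of
`r₀, r₁` is irrational. [folklore] -/
theorem cancellingWeights_injective {r₀ r₁ : ℝ} (hr₀ : r₀ ≠ 0)
    (hirr : Irrational r₀ ∨ Irrational r₁) {e₀ : ℝ} (he₀ : e₀ ≠ 0) (d d' : Fin 3 →₀ ℕ)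
    (h1 : (d 1 : ℝ) - (d 0 : ℝ) * r₁ / r₀ = (d' 1 : ℝ) - (d' 0 : ℝ) * r₁ / r₀)
    (h2 : (d 0 : ℝ) / (e₀ * r₀) + (d 2 : ℝ) / e₀ = (d' 0 : ℝ) / (e₀ * r₀) + (d' 2 : ℝ) / e₀) :
    d = d' := by
  -- `a = r₀ b` and `d₁ - d₁' = r₁ b` with `a = d₀ - d₀'`, `b = d₂' - d₂`
  have ha : ((d 0 : ℝ) - d' 0) = r₀ * ((d' 2 : ℝ) - d 2) := by
    have := h2
    field_simp at this
    linarith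
  have hb : ((d 1 : ℝ) - d' 1) = r₁ * ((d' 2 : ℝ) - d 2) := by
    have := h1
    field_simp at this
    -- `r₀ d₁ - d₀ r₁ = r₀ d₁' - d₀' r₁`, and `d₀ - d₀' = r₀ b`
    have h3 : r₀ * ((d 1 : ℝ) - d' 1) = r₁ * ((d 0 : ℝ) - d' 0) := by linarith
    rw [ha] at h3
    have h4 : r₀ * (((d 1 : ℝ) - d' 1) - r₁ * ((d' 2 : ℝ) - d 2)) = 0 := by linarith
    have := (mul_eq_zero.1 h4).resolve_left hr₀
    linarith
  by_cases hb0 : ((d' 2 : ℝ) - d 2) = 0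
  · rw [hb0, mul_zero, sub_eq_zero] at ha hb
    have h2' : d 2 = d' 2 := by
      have : (d' 2 : ℝ) = d 2 := by linarith
      exact_mod_cast this.symm
    have h0' : d 0 = d' 0 := by exact_mod_cast ha
    have h1' : d 1 = d' 1 := by exact_mod_cast hb
    ext i
    fin_cases i
    · exact h0'
    · exact h1'
    · exact h2'
  · exfalso
    have hr₀q : r₀ = ((d 0 : ℤ) - d' 0 : ℤ) / ((d' 2 : ℤ) - d 2 : ℤ) := by
      push_cast
      field_simp
      linarith
    have hr₁q : r₁ = ((d 1 : ℤ) - d' 1 : ℤ) / ((d' 2 : ℤ) - d 2 : ℤ) := by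
      push_cast
      field_simp
      linarith
    have hbZ : ((d' 2 : ℤ) - d 2 : ℤ) ≠ 0 := by exact_mod_cast hb0
    rcases hirr with h | h
    · exact (irrational_iff_ne_rational r₀).1 h _ _ hbZ hr₀q
    · exact (irrational_iff_ne_rational r₁).1 h _ _ hbZ hr₁q

/-- The admissible exponents form an open set. [folklore] -/
theorem isOpen_cancellingAdmissible (r₀ r₁ e₀ e₁ : ℝ) :
    IsOpen {β : ℝ | 0 < β ∧ β * e₁ < e₀ ∧ (β / e₀ - r₁) / r₀ < β} := by
  refine (isOpen_lt continuous_const continuous_id).inter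
    ((isOpen_lt (continuous_id.mul continuous_const) continuous_const).inter
      (isOpen_lt (((continuous_id.div_const _).sub continuous_const).div_const _) continuous_id))

end Weights

section Density

/-- **THEOREM (Zariski density in the cancelling-fibre regime).**  `F₀ ≠ 0`, `r₀ ≠ 0`, one of
`r₀, r₁` irrational, `c ∈ ℂ`, and one admissible exponent `β` (`β > 0`, `β(deg F₁ + 1) < deg F₀ + 1`,
`(β/(deg F₀ + 1) - r₁)/r₀ < β`): then
`W = {x₂ = r₀x₀ + r₁x₁ + c, y₀ = x₀ + y₂F₀(y₂), y₁ = x₁ + y₂F₁(y₂)}` has `I(W ∩ Γ_exp) = I(W)`. (new)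
[cite: MantovaMasser2023, §1 p.5 (the open case dim π(V) = 2 in ℂ³×ℂˣ³)] -/
theorem unprojectedDense_polyFibredGraph_cancelling (F : Fin 2 → Polynomial ℂ) (hF0 : F 0 ≠ 0)
    (r₀ r₁ : ℝ) (hr₀ : r₀ ≠ 0) (hirr : Irrational r₀ ∨ Irrational r₁) (c : ℂ)
    (hadm : ∃ β : ℝ, 0 < β ∧ β * ((F 1).natDegree + 1 : ℕ) < ((F 0).natDegree + 1 : ℕ) ∧
      (β / ((F 0).natDegree + 1 : ℕ) - r₁) / r₀ < β) :
    UnprojectedDense (polyFibredGraph (hyperplanePoly ![r₀, r₁] c) (fun j => X j)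
      (fun j => (F j).toMvPolynomial 0)) := by
  classical
  set e₀ : ℕ := (F 0).natDegree + 1 with he₀def
  set e₁ : ℕ := (F 1).natDegree + 1 with he₁def
  have he₀ : 1 ≤ e₀ := by omega
  have he₀R : (e₀ : ℝ) ≠ 0 := by exact_mod_cast (show e₀ ≠ 0 by omega)
  have he₀pos : (0 : ℝ) < e₀ := by exact_mod_cast (show 0 < e₀ by omega)
  have he₀1 : (1 : ℝ) ≤ e₀ := by exact_mod_cast he₀
  have hdeg0 : (F 0).natDegree < e₀ := by omega
  have hdeg1 : (F 1).natDegree < e₁ := by omega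
  set A : Fin 2 → ℕ → ℂ := fun j i => (F j).coeff i with hA
  have ha₀ : A 0 (e₀ - 1) ≠ 0 := by
    simp only [hA, he₀def, Nat.add_sub_cancel, Polynomial.coeff_natDegree]
    exact Polynomial.leadingCoeff_ne_zero.2 hF0
  set r : Fin 2 → ℝ := ![r₀, r₁] with hrdef
  set C₁ : ℝ := 2 * Real.pi / (|r₀| * ‖A 0 (e₀ - 1)‖) with hC₁
  -- the admissible set is a neighbourhood of the given exponent
  obtain ⟨β₀, hβ₀⟩ := hadm
  have hU : {β : ℝ | 0 < β ∧ β * e₁ < e₀ ∧ (β / e₀ - r₁) / r₀ < β} ∈ 𝓝 β₀ :=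
    (isOpen_cancellingAdmissible r₀ r₁ e₀ e₁).mem_nhds hβ₀
  refine unprojectedDense_of_powerGrowth_family (isIrreducibleClosed_polyFibredGraph _ _ _)
    (by rw [zariskiDim_polyFibredGraph]) ![Sum.inr 0, Sum.inl 1, Sum.inr 2] fun H hH => ?_
  -- an admissible `β` with injective weights on the support of `H`
  obtain ⟨β, ⟨hβ, hβ₁, hγ⟩, hinj⟩ := exists_mem_injOn_affine H.support
    (fun d : Fin 3 →₀ ℕ => (d 1 : ℝ) - (d 0 : ℝ) * r₁ / r₀)
    (fun d : Fin 3 →₀ ℕ => (d 0 : ℝ) / (e₀ * r₀) + (d 2 : ℝ) / e₀)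
    (fun d _ d' _ h1 h2 => cancellingWeights_injective hr₀ hirr he₀R d d' h1 h2) hU
  set γ : Fin 3 → ℝ := ![(β / e₀ - r₁) / r₀, 1, β / e₀] with hγdef
  have hw : (fun d : Fin 3 →₀ ℕ => ∑ i, (d i : ℝ) * γ i) =
      fun d => ((d 1 : ℝ) - (d 0 : ℝ) * r₁ / r₀) + β * ((d 0 : ℝ) / (e₀ * r₀) + (d 2 : ℝ) / e₀) := by
    funext d
    rw [Fin.sum_univ_three]
    simp only [hγdef, Matrix.cons_val_zero, Matrix.cons_val_one, Matrix.cons_val_two,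
      Matrix.tail_cons, Matrix.head_cons]
    field_simp
    ring
  refine ⟨γ, by rw [hw]; exact hinj, ?_⟩
  -- the solutions of the existence theorem
  obtain ⟨K, n, x, u, hK, hu, hx1, hℓ, hx0, hsol⟩ :=
    exists_solutions_cancellingFibre e₀ he₀ e₁ A ha₀ r₀ r₁ hr₀ c hβ hβ₁ hγ
  set P3 : ℕ → Fin 3 ⊕ Fin 3 → ℂ := fun m =>
    pgParam (hyperplanePoly r c) (fun j => X j) (fun j => (F j).toMvPolynomial 0)
      (x m) (exp (∑ i, (r i : ℂ) * x m i + c)) with hP3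
  set E : ℝ := (2 * Real.pi + 1) + (|Real.log C₁| + Real.log 2 + 1) +
    ((|Real.log C₁| + Real.log 2 + 1) + |r₁| * (|Real.log (2 * Real.pi)| + 1) + ‖c‖) / |r₀| with hE
  have hE1 : 0 ≤ |Real.log C₁| + Real.log 2 + 1 := by positivity
  have hE2 : 0 ≤ ((|Real.log C₁| + Real.log 2 + 1) + |r₁| * (|Real.log (2 * Real.pi)| + 1) + ‖c‖) /
      |r₀| := by positivity
  -- the solution property in the shape of `pgParam_hyperplane_mem_expGraph`
  have hsolW : ∀ᶠ m in atTop, ∀ j : Fin 2, exp (x m j) = eval (x m) (X j) +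
      exp (∑ i, (r i : ℂ) * x m i + c) * (F j).eval (exp (∑ i, (r i : ℂ) * x m i + c)) := by
    filter_upwards [hsol] with m hm
    rw [Fin.forall_fin_two]
    refine ⟨?_, ?_⟩
    · rw [eval_X, Polynomial.eval_eq_sum_range' hdeg0]; exact hm.1
    · rw [eval_X, Polynomial.eval_eq_sum_range' hdeg1]; exact hm.2
  -- smallness of `u`
  have hu1 : ∀ᶠ m in atTop, ‖(u m).1‖ ≤ 1 ∧ ‖(u m).2‖ ≤ 1 := by
    have h := (tendsto_zero_iff_norm_tendsto_zero.1 hu).eventually (ge_mem_nhds zero_lt_one)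
    filter_upwards [h] with m hm
    exact ⟨(norm_fst_le (u m)).trans hm, (norm_snd_le (u m)).trans hm⟩
  refine ⟨P3, fun m => Real.log m, E, Real.tendsto_log_atTop.comp tendsto_natCast_atTop_atTop,
    ?_, fun i => ?_⟩
  · filter_upwards [hsolW] with m hm
    exact ⟨pgParam_mem _ _ _ _ _, pgParam_hyperplane_mem_expGraph r c (fun j => X j) F hm⟩
  -- real parts of the building blocks
  have hreℓ : ∀ m, 1 ≤ m → (∑ i, (r i : ℂ) * x m i + c).re =
      (Real.log C₁ + Real.log (K m) + (u m).2.re) / e₀ := by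
    intro m hm
    have hKpos : 0 < K m := by linarith [one_le_of_rpow_le hβ (fun m => (hK m).1) hm]
    rw [hℓ m, Complex.add_re, Complex.div_natCast_re, Complex.add_re,
      re_log_label_quot hKpos hr₀ ha₀, show (2 * Real.pi * I * (n m : ℂ)) =
        2 * Real.pi * I * (((n m : ℝ)) : ℂ) by norm_cast, re_two_pi_I_mul_ofReal, zero_add]
  have hrex1 : ∀ m : ℕ, (x m 1).re = Real.log (2 * Real.pi * m) + (u m).1.re := by
    intro m
    rw [hx1 m, Complex.add_re, Complex.add_re, re_log_two_pi_I_mul_natCast,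
      show (2 * Real.pi * I * (m : ℂ)) = 2 * Real.pi * I * (((m : ℝ)) : ℂ) by norm_cast,
      re_two_pi_I_mul_ofReal, add_zero]
  have hlogK : ∀ m, 1 ≤ m → |Real.log (K m) - β * Real.log m| ≤ Real.log 2 := by
    intro m hm
    obtain ⟨h1, h2⟩ := log_sandwich hβ hK hm
    rw [abs_le]; constructor <;> linarith [Real.log_nonneg one_le_two]
  fin_cases i
  · -- `y₀ = e^{x₀}`: `log |y₀| = Re x₀ = (Re ℓ - r₁ Re x₁ - Re c)/r₀`
    simp only [hγdef, Fin.zero_eta, Matrix.cons_val_zero]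
    filter_upwards [hsolW, hu1, eventually_ge_atTop 1] with m hm hum hm1
    have hcoord : P3 m (Sum.inr 0) = exp (x m 0) := by
      have e0 : (Sum.inr 0 : Fin 3 ⊕ Fin 3) = Sum.inr (Fin.castSucc (0 : Fin 2)) := rfl
      simp only [hP3, e0, pgParam_inr, pMulParam_castSucc]
      rw [hm 0, MvPolynomial.eval_toMvPolynomial, Fin.cons_zero]
    refine ⟨by rw [hcoord]; exact Complex.exp_ne_zero _, ?_⟩
    rw [hcoord, Complex.norm_exp, Real.log_exp, hx0 m, Complex.div_ofReal_re, Complex.sub_re,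
      Complex.sub_re, hreℓ m hm1, Complex.re_ofReal_mul, hrex1 m,
      Real.log_mul (by positivity) (by exact_mod_cast (show m ≠ 0 by omega))]
    have hu1r : |(u m).1.re| ≤ 1 := (Complex.abs_re_le_norm _).trans hum.1
    have hu2r : |(u m).2.re| ≤ 1 := (Complex.abs_re_le_norm _).trans hum.2
    have hnum : |((Real.log C₁ + Real.log (K m) + (u m).2.re) / e₀ -
        r₁ * (Real.log (2 * Real.pi) + Real.log m + (u m).1.re) - c.re) -
        (β / e₀ - r₁) * Real.log m| ≤
        (|Real.log C₁| + Real.log 2 + 1) + |r₁| * (|Real.log (2 * Real.pi)| + 1) + ‖c‖ := by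
      have hsplit : ((Real.log C₁ + Real.log (K m) + (u m).2.re) / e₀ -
          r₁ * (Real.log (2 * Real.pi) + Real.log m + (u m).1.re) - c.re) -
          (β / e₀ - r₁) * Real.log m =
          (Real.log C₁ + (Real.log (K m) - β * Real.log m) + (u m).2.re) / e₀ -
            r₁ * (Real.log (2 * Real.pi) + (u m).1.re) - c.re := by
        ring
      rw [hsplit]
      have hA1 : |(Real.log C₁ + (Real.log (K m) - β * Real.log m) + (u m).2.re) / e₀| ≤
          |Real.log C₁| + Real.log 2 + 1 := by
        rw [abs_div, abs_of_pos he₀pos]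
        calc |Real.log C₁ + (Real.log (K m) - β * Real.log m) + (u m).2.re| / e₀
            ≤ |Real.log C₁ + (Real.log (K m) - β * Real.log m) + (u m).2.re| / 1 :=
              div_le_div_of_nonneg_left (abs_nonneg _) one_pos he₀1
          _ ≤ |Real.log C₁| + Real.log 2 + 1 := by
              rw [div_one]
              have h1 := abs_add_le (Real.log C₁ + (Real.log (K m) - β * Real.log m)) (u m).2.re
              have h2 := abs_add_le (Real.log C₁) (Real.log (K m) - β * Real.log m)
              linarith [hlogK m hm1, hu2r]
      have hA2 : |r₁ * (Real.log (2 * Real.pi) + (u m).1.re)| ≤ |r₁| * (|Real.log (2 * Real.pi)| + 1) := by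
        rw [abs_mul]
        exact mul_le_mul_of_nonneg_left ((abs_add_le _ _).trans (add_le_add le_rfl hu1r))
          (abs_nonneg _)
      have hA3 : |c.re| ≤ ‖c‖ := Complex.abs_re_le_norm c
      calc _ ≤ |(Real.log C₁ + (Real.log (K m) - β * Real.log m) + (u m).2.re) / e₀ -
            r₁ * (Real.log (2 * Real.pi) + (u m).1.re)| + |c.re| := abs_sub _ _
        _ ≤ (|(Real.log C₁ + (Real.log (K m) - β * Real.log m) + (u m).2.re) / e₀| +
            |r₁ * (Real.log (2 * Real.pi) + (u m).1.re)|) + |c.re| := by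
              gcongr; exact abs_sub _ _
        _ ≤ _ := by linarith
    rw [show ((Real.log C₁ + Real.log (K m) + (u m).2.re) / e₀ -
        r₁ * (Real.log (2 * Real.pi) + Real.log m + (u m).1.re) - c.re) / r₀ -
        (β / e₀ - r₁) / r₀ * Real.log m =
        (((Real.log C₁ + Real.log (K m) + (u m).2.re) / e₀ -
          r₁ * (Real.log (2 * Real.pi) + Real.log m + (u m).1.re) - c.re) -
          (β / e₀ - r₁) * Real.log m) / r₀ by ring, abs_div]
    calc _ ≤ ((|Real.log C₁| + Real.log 2 + 1) + |r₁| * (|Real.log (2 * Real.pi)| + 1) + ‖c‖) / |r₀| :=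
          div_le_div_of_nonneg_right hnum (abs_nonneg _)
      _ ≤ E := by rw [hE]; linarith [Real.pi_pos]
  · -- `x₁`: `x₁/(2πim) → 1`
    simp only [hγdef, Fin.mk_one, Matrix.cons_val_one, Matrix.cons_val_zero]
    have hg : Tendsto (fun m : ℕ => (2 * Real.pi * I * (m : ℂ))⁻¹ * Complex.log (2 * Real.pi * I * (m : ℂ)) +
        (2 * Real.pi * I * (m : ℂ))⁻¹ * (u m).1) atTop (𝓝 0) := by
      rw [show (0 : ℂ) = 0 + 0 by simp]
      refine tendsto_param_nu₁.add ?_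
      have h1 : Tendsto (fun m : ℕ => (2 * Real.pi * I * (m : ℂ))⁻¹) atTop (𝓝 0) := tendsto_param_mu₁
      refine squeeze_zero_norm' ?_ (tendsto_zero_iff_norm_tendsto_zero.1 h1)
      filter_upwards [hu1] with m hum
      rw [norm_mul]
      exact mul_le_of_le_one_right (norm_nonneg _) hum.1
    have hsmall := (tendsto_zero_iff_norm_tendsto_zero.1 hg).eventually
      (gt_mem_nhds (show (0 : ℝ) < 1 / 2 by norm_num))
    filter_upwards [hsmall, eventually_ge_atTop 1] with m hm hm1
    have hmpos : (0 : ℝ) < m := by exact_mod_cast hm1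
    have h2πim : (2 * Real.pi * I * (m : ℂ)) ≠ 0 :=
      mul_ne_zero Complex.two_pi_I_ne_zero (by exact_mod_cast (show m ≠ 0 by omega))
    have hn2 : ‖2 * Real.pi * I * (m : ℂ)‖ = 2 * Real.pi * m := norm_two_pi_I_mul_natCast m
    have hcoord : P3 m (Sum.inl 1) = x m 1 := by
      have e1 : (Sum.inl 1 : Fin 3 ⊕ Fin 3) = Sum.inl (Fin.castSucc (1 : Fin 2)) := rfl
      simp only [hP3, e1, pgParam_inl_castSucc]
    -- `x₁ = 2πim (1 + g)` with `‖g‖ < 1/2`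
    have hμm : (2 * Real.pi * I * (m : ℂ)) * (2 * Real.pi * I * (m : ℂ))⁻¹ = 1 :=
      mul_inv_cancel₀ h2πim
    have hx1g : x m 1 = 2 * Real.pi * I * (m : ℂ) *
        (1 + ((2 * Real.pi * I * (m : ℂ))⁻¹ * Complex.log (2 * Real.pi * I * (m : ℂ)) +
          (2 * Real.pi * I * (m : ℂ))⁻¹ * (u m).1)) := by
      rw [hx1 m]
      linear_combination (-(Complex.log (2 * Real.pi * I * (m : ℂ)) + (u m).1)) * hμm
    set g : ℂ := (2 * Real.pi * I * (m : ℂ))⁻¹ * Complex.log (2 * Real.pi * I * (m : ℂ)) +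
      (2 * Real.pi * I * (m : ℂ))⁻¹ * (u m).1 with hgdef
    have hg1 : 1 / 2 ≤ ‖1 + g‖ := by
      have := norm_sub_norm_le (1 : ℂ) (-g)
      rw [norm_one, norm_neg, sub_neg_eq_add] at this
      linarith
    have hg2 : ‖1 + g‖ ≤ 2 := by
      have := norm_add_le (1 : ℂ) g
      rw [norm_one] at this
      linarith
    have hnx : ‖x m 1‖ = 2 * Real.pi * m * ‖1 + g‖ := by rw [hx1g, norm_mul, hn2]
    have hpos : 0 < ‖x m 1‖ := by rw [hnx]; positivity
    refine ⟨by rw [hcoord]; exact norm_pos_iff.1 hpos, ?_⟩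
    rw [hcoord, hnx, Real.log_mul (by positivity) (by linarith), Real.log_mul (by positivity) hmpos.ne',
      one_mul]
    have hl1 : |Real.log (2 * Real.pi)| ≤ 2 * Real.pi := by
      rw [abs_le]
      constructor
      · linarith [Real.log_nonneg (show (1 : ℝ) ≤ 2 * Real.pi by linarith [Real.two_le_pi]),
          Real.pi_pos]
      · have := Real.log_le_sub_one_of_pos (show (0 : ℝ) < 2 * Real.pi by positivity)
        linarith
    have hl2 : |Real.log ‖1 + g‖| ≤ 1 := by
      rw [abs_le]
      constructor
      · have := Real.log_le_log (by norm_num) hg1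
        have h12 : Real.log (1 / 2) = -Real.log 2 := by
          rw [one_div, Real.log_inv]
        linarith [Real.log_two_lt_d9]
      · have := Real.log_le_log (by linarith) hg2
        linarith [Real.log_two_lt_d9]
    rw [show Real.log (2 * Real.pi) + Real.log m + Real.log ‖1 + g‖ - Real.log m =
      Real.log (2 * Real.pi) + Real.log ‖1 + g‖ by ring]
    calc _ ≤ |Real.log (2 * Real.pi)| + |Real.log ‖1 + g‖| := abs_add_le _ _
      _ ≤ 2 * Real.pi + 1 := by linarith
      _ ≤ E := by rw [hE]; linarith
  · -- `y₂ = e^{ℓ}`: `log |y₂| = Re ℓ`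
    simp only [hγdef, Fin.reduceFinMk, Matrix.cons_val_two, Matrix.tail_cons, Matrix.head_cons]
    filter_upwards [hu1, eventually_ge_atTop 1] with m hum hm1
    have hcoord : P3 m (Sum.inr 2) = exp (∑ i, (r i : ℂ) * x m i + c) := by
      have e2 : (Sum.inr 2 : Fin 3 ⊕ Fin 3) = Sum.inr (Fin.last 2) := rfl
      simp only [hP3, e2, pgParam_inr, pMulParam_last]
    refine ⟨by rw [hcoord]; exact Complex.exp_ne_zero _, ?_⟩
    rw [hcoord, Complex.norm_exp, Real.log_exp, hreℓ m hm1]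
    have hu2r : |(u m).2.re| ≤ 1 := (Complex.abs_re_le_norm _).trans hum.2
    rw [show (Real.log C₁ + Real.log (K m) + (u m).2.re) / e₀ - β / e₀ * Real.log m =
      (Real.log C₁ + (Real.log (K m) - β * Real.log m) + (u m).2.re) / e₀ by ring,
      abs_div, abs_of_pos he₀pos]
    calc |Real.log C₁ + (Real.log (K m) - β * Real.log m) + (u m).2.re| / e₀
        ≤ |Real.log C₁ + (Real.log (K m) - β * Real.log m) + (u m).2.re| / 1 :=
          div_le_div_of_nonneg_left (abs_nonneg _) one_pos he₀1
      _ ≤ |Real.log C₁| + Real.log 2 + 1 := by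
          rw [div_one]
          have h1 := abs_add_le (Real.log C₁ + (Real.log (K m) - β * Real.log m)) (u m).2.re
          have h2 := abs_add_le (Real.log C₁) (Real.log (K m) - β * Real.log m)
          linarith [hlogK m hm1, hu2r]
      _ ≤ E := by rw [hE]; linarith [Real.pi_pos]

end Density

end Summit.Schanuel.Schanuel.Theorems

end
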